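import Summits.Langlands.Langlands.Theses.RegularSerreAbelianSurfaces
import Summits.Langlands.Langlands.Theses.PrimeSwitchSplit
import HarnessLib

/-!
# Line `leaves_RegularSerreAbelianSurfaces` — registered skeleton (BC2 redirect / BC3) for the junction crux
`RegularSerreAbelianSurfaces.SectorComplement` (stmt-Langlands-17571)

Crux-strategist `cstrat-stmt-Langlands-17571-r1` (EXEMPT-46 re-exam, bin RESTATED → redirect), 2026-08-17.

`SectorComplement := AbelianSurfacesModular(text inlined) → _root_.Langlands` is the route's declared
COMPLEMENT of the abelian-surface sector. Given the route target it IS the summit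
(`sectorComplement_iff_langlands_of_target` below), so it passes BC2 only as a REDIRECT onto a typed
decomposition. The decomposition is the tree's own typed partition of `GL_n` reciprocity — the six
leaves of route PrimeSwitchSplit (rev 4), ALL EXISTING ITEMS, consumed here BY NAME:

| stub | leaf (by name) | item | kind | plan |
|---|---|---|---|---|
| `stub_weakGeometricAutomorphy` | `PrimeSwitchSplit.WeakGeometricAutomorphy` (B_w) | stmt-Langlands-17414 | crux | registered birth (rankOne/higherRank), served |
| `stub_satakeAvatarExistence` | `PrimeSwitchSplit.SatakeAvatarExistence` (W⁺) | stmt-Langlands-17415 | crux | registered birth, served ×2 routes |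
| `stub_padicMemberCompatibility` | `PrimeSwitchSplit.PadicMemberCompatibility` (P) | stmt-Langlands-17534 | crux | registered birth, served ×2 routes |
| `stub_compatibilityAwayFromLR` | `PrimeSwitchSplit.CompatibilityAwayFromLR` (L∤R) | stmt-Langlands-18084 | crux | registered birth (4 stubs), served |
| `stub_canonicalReciprocityData` | `PrimeSwitchSplit.CanonicalReciprocityData` (CRD) | stmt-Langlands-17930 | support | registered birth; fact debt |
| `stub_avatarConjugacy` | `PrimeSwitchSplit.AvatarConjugacy` (U) | stmt-Langlands-17844 | support | provable now (kernel-checked candidate, cone-gated) |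

Composition `SectorComplement_of` is KERNEL-CHECKED with no `sorry`: it is `PrimeSwitchSplit.closes`
(the landed deciding theorem of that route: prime switch through `ℓ' ∈ {2,3}`) after discarding the
junction's antecedent. HONEST FLAG: the antecedent `AbelianSurfacesModular` is bound as `_hX` and not
used — it is an INSTANCE of B_w (weight-1 rank-4 symplectic sector over `ℚ`) modulo two textbook
facts absent from the tree (`H¹_ét(A)` unramified a.e.; de Rham above `ℓ` for Fontaine's pinned datum),
so no typed partition of the complement can consume it (STRATEGY-CENSUS §0). The texts-only twin of the
glue (landable as `Theorems/RegularSerreAbelianSurfacesSectorComplementSplit.lean`, closes the split's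
glue item by `exact`) is `Lines/RegularSerreAbelianSurfacesSectorComplementOfLeaves.lean`.

`lean check`: rc 0; sorries = 6 = the `stub_*`; `SectorComplement_of` concludes
`Summit.Langlands.Langlands.Theses.RegularSerreAbelianSurfaces.SectorComplement` BY NAME.
Piece probes (BC2(c)/BC3): each stub statement → `Langlands` and → `SectorComplement` under
`first | exact? | simpa | unfold; simpa | aesop` and the three singles: FAILED 12/12 targets, 48/48 runs
(folder `bc/probe_<Leaf>.lean|json`); control `Langlands → SectorComplement` compiles.
-/

noncomputable section

set_option linter.dupNamespace false

namespace Summit.Langlands.Langlands.Cruxes.SectorComplement.LeavesRegularSerreAbelianSurfaces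

open Summit.Langlands.Langlands.Theses
open Summit.Langlands.Langlands.Theses.RegularSerreAbelianSurfaces

/-! ## 0. Position of the crux (kernel-checked bookkeeping) -/

/-- The junction is literally `Target → Langlands`. [folklore] -/
theorem sectorComplement_iff :
    RegularSerreAbelianSurfaces.SectorComplement ↔ (AbelianSurfacesModular → _root_.Langlands) :=
  Iff.rfl

/-- The summit implies the junction (discard the sector hypothesis). [folklore] -/
theorem sectorComplement_of_langlands (h : _root_.Langlands) :
    RegularSerreAbelianSurfaces.SectorComplement := fun _ => h

/-- Under the route target the junction IS the summit — the RESTATED signal, honestly. [folklore] -/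
theorem sectorComplement_iff_langlands_of_target (hT : AbelianSurfacesModular) :
    RegularSerreAbelianSurfaces.SectorComplement ↔ _root_.Langlands :=
  ⟨fun h => h hT, fun h _ => h⟩

/-! ## 1. The stubs — the six leaves BY NAME (each an existing, separately staffed item) -/

/-- **stub B_w** = item stmt-Langlands-17414 by name (Fontaine–Mazur–Langlands, a.e. form; direction (B) core).
Why plausibly true: it is the weak form of the summit's direction (B). Size: open problem.
[cite: FontaineMazurGeometric1995, Conj. 1] [cite: BuzzardGeeLMS2014, Conj. 3.2.2] -/
theorem stub_weakGeometricAutomorphy : PrimeSwitchSplit.WeakGeometricAutomorphy := by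
  sorry

/-- **stub W⁺** = item stmt-Langlands-17415 by name (irreducible Satake avatar; direction (A) core).
Why plausibly true: Buzzard–Gee 3.2.2 + Ramakrishnan's cuspidal ⇒ irreducible. Size: open problem.
[cite: BuzzardGeeLMS2014, Conj. 3.2.2] -/
theorem stub_satakeAvatarExistence : PrimeSwitchSplit.SatakeAvatarExistence := by
  sorry

/-- **stub P** = item stmt-Langlands-17534 by name (de Rham member + prime switch at `v ∣ ℓ`).
Why plausibly true: Fontaine's `C_WD` for the automorphic compatible system. Size: open problem.
[cite: FontaineAsterisque223VIII, §2.3.7] [cite: AHTW2026, Thm. 1.2.1] -/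
theorem stub_padicMemberCompatibility : PrimeSwitchSplit.PadicMemberCompatibility := by
  sorry

/-- **stub L∤R** = item stmt-Langlands-18084 by name (Taylor Conj. 7 at `v ∤ ℓ`, every datum).
Why plausibly true: Taylor 2004 Conj. 7; known in the regular polarizable CM sector. Size: open problem.
[cite: TaylorGaloisRepresentations2004, Conj. 7] [cite: VarmaFMS2024, Thm. 1] -/
theorem stub_compatibilityAwayFromLR : PrimeSwitchSplit.CompatibilityAwayFromLR := by
  sorry

/-- **stub CRD** = item stmt-Langlands-17930 by name (the summit's non-vacuity conjunct; fact debt).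
Why plausibly true: Harris–Taylor Thm. A / Henniart + Deligne's canonical ε. Size: XL fact debt.
[cite: HarrisTaylorAMS2001, Thm. A] [cite: Deligne1973Constantes, Thm. 4.1] -/
theorem stub_canonicalReciprocityData : PrimeSwitchSplit.CanonicalReciprocityData := by
  sorry

/-- **stub U** = item stmt-Langlands-17844 by name (conjugacy of irreducible Satake avatars).
PROVABLE NOW (one line from the landed `isConjugate_of_satakeFrobCompatibleAt`, p119850; landing is
cone-gated on refactor wi-37501). Size: S.
[cite: DeligneSerreASENS1974, Lemme 3.2] -/
theorem stub_avatarConjugacy : PrimeSwitchSplit.AvatarConjugacy := by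
  sorry

namespace _Goal

/-- The statement of `stub_weakGeometricAutomorphy` (literally its type). [folklore] -/
def stub_weakGeometricAutomorphy : Prop :=
  type_of% @LeavesRegularSerreAbelianSurfaces.stub_weakGeometricAutomorphy
/-- The statement of `stub_satakeAvatarExistence`. [folklore] -/
def stub_satakeAvatarExistence : Prop :=
  type_of% @LeavesRegularSerreAbelianSurfaces.stub_satakeAvatarExistence
/-- The statement of `stub_padicMemberCompatibility`. [folklore] -/
def stub_padicMemberCompatibility : Prop :=
  type_of% @LeavesRegularSerreAbelianSurfaces.stub_padicMemberCompatibility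
/-- The statement of `stub_compatibilityAwayFromLR`. [folklore] -/
def stub_compatibilityAwayFromLR : Prop :=
  type_of% @LeavesRegularSerreAbelianSurfaces.stub_compatibilityAwayFromLR
/-- The statement of `stub_canonicalReciprocityData`. [folklore] -/
def stub_canonicalReciprocityData : Prop :=
  type_of% @LeavesRegularSerreAbelianSurfaces.stub_canonicalReciprocityData
/-- The statement of `stub_avatarConjugacy`. [folklore] -/
def stub_avatarConjugacy : Prop :=
  type_of% @LeavesRegularSerreAbelianSurfaces.stub_avatarConjugacy

end _Goal

/-! ## 2. The composition (kernel-checked, no `sorry`) -/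

/-- **`SectorComplement` from the six leaves**: the landed deciding theorem of route PrimeSwitchSplit
proves `Langlands` from them; the junction follows by discarding its antecedent (`_hX`, census §0). -/
theorem SectorComplement_of
    (hB : _Goal.stub_weakGeometricAutomorphy) (hW : _Goal.stub_satakeAvatarExistence)
    (hP : _Goal.stub_padicMemberCompatibility) (hA : _Goal.stub_compatibilityAwayFromLR)
    (hR : _Goal.stub_canonicalReciprocityData) (hU : _Goal.stub_avatarConjugacy) :
    Summit.Langlands.Langlands.Theses.RegularSerreAbelianSurfaces.SectorComplement :=
  fun _hX => PrimeSwitchSplit.closes hB hW hP hA hR hU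

/-- By-name sanity: the stubs feed the composition. -/
example : Summit.Langlands.Langlands.Theses.RegularSerreAbelianSurfaces.SectorComplement :=
  SectorComplement_of stub_weakGeometricAutomorphy stub_satakeAvatarExistence
    stub_padicMemberCompatibility stub_compatibilityAwayFromLR stub_canonicalReciprocityData
    stub_avatarConjugacy

/-! Converse bookkeeping: `Langlands → SectorComplement` is trivial (above), and `Langlands → leaf`
is certified per leaf elsewhere (PrimeSwitchSplit `bc/SubsOfLanglandsR.lean`; the refuters' birth
certificates of 17414/17415/17534/18084): the six leaves are consequences of `Langlands` USED toward it
(`wuc`-admissible); jointly `Langlands ↔ B_w ∧ W⁺ ∧ P ∧ L∤R ∧ CRD` (U a theorem); no single leaf is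
equivalent to `Langlands` or to this crux (piece probes 12/12 failed). -/

end Summit.Langlands.Langlands.Cruxes.SectorComplement.LeavesRegularSerreAbelianSurfaces

end
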